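import Summits.AtomisticToContinuum.HydrodynamicLimit.Theorems.AntiMazurCoboundariesCellForecastPressureDecayClusterTailChargingBound
import HarnessLib

/-!
# S2e-1 · the short-time cluster tail: the weighted first-order bound
# (registered sub-goal `stub_clusterTail_firstOrder` of stub `stub_clusterTail`, crux line
# `enskog-compensator-martingale`, crux `CellForecastPressureDecay`, stmt-AtomisticToContinuum-13915)

Under the canonical cell law `P_{n,L}` (`n ≤ 2L³` spheres of diameter `σ ≤ 3/16`, `L ≥ 1`), the expected number
of spheres that take part in a collision of the slab `(0, Δ]`, weighted by `1 + ‖vᵢ‖²`, is `≤ C L³ Δ`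
(`stub_clusterTail_firstOrder`), WITHOUT a cluster expansion: pathwise on the good set, a sphere that is not free
is charged, for every fine enough mesh `Δ/M`, to the event that its initial datum flown freely to a grid time lies
in a Boltzmann cylinder of length `Δ/M` around the simultaneous state of a sphere of the bath evolved WITHOUT it
(`exists_first_participation`, `eventually_exists_grid_charge`), so that the weighted count is dominated by the inferior limit of measurable
charging functionals; Fatou's lemma and the integrated charging bound (`lintegral_chargingTerm_le`: insertion
inequality, Tonelli over the inserted position, mean bath speed by energy conservation) give
`∑ᵢ 2 L⁻³ σ² Δ |S²| m E[(1 + ‖w‖²)(‖w‖ + 4)] = O(n² Δ / L³) = O(L³ Δ)`.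

References: Cercignani–Illner–Pulvirenti 1994, §2.2, App. 4.A (collision cylinders, a.e. dynamics);
Gallagher–Saint-Raymond–Texier 2013, §4.1; Lanford 1975, §3 (short-time cluster estimates).
-/

noncomputable section

open MeasureTheory ProbabilityTheory Set Filter Topology
open scoped ENNReal BigOperators InnerProductSpace
open Literature.Analysis.FluidPDE Literature.MathematicalPhysics.KineticTheory

namespace Summit.AtomisticToContinuum.HydrodynamicLimit.Theorems.EnskogCompensator

variable {σ L : ℝ} {m : ℕ}

/-! ## Constants -/

/-- The Maxwellian moment `E[(1 + ‖w‖²)(‖w‖ + 4)]` is finite (Fernique / fourth moments). [folklore] -/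
theorem lintegral_weight_lt_top :
    ∫⁻ w, ENNReal.ofReal ((1 + ‖w‖ ^ 2) * (‖w‖ + 4)) ∂stdGaussian V3 < ∞ := by
  have hint : Integrable (fun w : V3 => 9 / 2 * (1 + 2 * ‖w‖ ^ 2 + ‖w‖ ^ 4)) (stdGaussian V3) :=
    (((integrable_const 1).add (integrable_norm_sq_stdGaussian.const_mul 2)).add
      integrable_norm_pow_four_stdGaussian).const_mul _
  refine lt_of_le_of_lt (lintegral_mono fun w => ENNReal.ofReal_le_ofReal ?_) hint.lintegral_lt_top
  nlinarith [mul_nonneg (add_nonneg zero_le_one (sq_nonneg ‖w‖)) (sq_nonneg (3 * ‖w‖ - 1 / 3)), sq_nonneg ‖w‖,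
    norm_nonneg w]

/-- The surface measure of the unit sphere is finite. [folklore] -/
theorem sphereMeasure_univ_ne_top : sphereMeasure (Set.univ : Set (Metric.sphere (0 : V3) 1)) ≠ ∞ := by
  haveI : IsFiniteMeasure (sphereMeasure : Measure (Metric.sphere (0 : V3) 1)) := by
    unfold sphereMeasure; infer_instance
  exact measure_ne_top _ _

/-- Bookkeeping of the constants: `(m+1) · 2 L⁻³ σ² Δ S · m K ≤ 8 σ² S K L³ Δ` for `m + 1 ≤ 2L³`. [folklore] -/
theorem firstOrder_bookkeeping {Δ : ℝ} (hL : 1 ≤ L) (hΔ : 0 ≤ Δ) (hm : ((m + 1 : ℕ) : ℝ) ≤ 2 * L ^ 3)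
    {S K : ℝ≥0∞} (hS : S ≠ ∞) (hK : K ≠ ∞) :
    ((m + 1 : ℕ) : ℝ≥0∞) * (2 * (ENNReal.ofReal ((L ^ 3)⁻¹) * ENNReal.ofReal (σ ^ 2 * Δ) * S) *
        (ENNReal.ofReal m * K)) ≤
      ENNReal.ofReal (8 * σ ^ 2 * S.toReal * K.toReal * L ^ 3 * Δ) := by
  have hL0 : 0 < L := one_pos.trans_le hL
  have hfin : ((m + 1 : ℕ) : ℝ≥0∞) * (2 * (ENNReal.ofReal ((L ^ 3)⁻¹) * ENNReal.ofReal (σ ^ 2 * Δ) * S) *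
      (ENNReal.ofReal m * K)) ≠ ∞ :=
    ENNReal.mul_ne_top (ENNReal.natCast_ne_top _) (ENNReal.mul_ne_top (ENNReal.mul_ne_top ENNReal.ofNat_ne_top
      (ENNReal.mul_ne_top (ENNReal.mul_ne_top ENNReal.ofReal_ne_top ENNReal.ofReal_ne_top) hS))
      (ENNReal.mul_ne_top ENNReal.ofReal_ne_top hK))
  rw [ENNReal.le_ofReal_iff_toReal_le hfin (by positivity)]
  simp only [ENNReal.toReal_mul, ENNReal.toReal_natCast, ENNReal.toReal_ofNat,
    ENNReal.toReal_ofReal (inv_nonneg.2 (pow_nonneg hL0.le 3)), ENNReal.toReal_ofReal (by positivity : 0 ≤ σ ^ 2 * Δ),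
    ENNReal.toReal_ofReal (Nat.cast_nonneg m)]
  have hmm : ((m + 1 : ℕ) : ℝ) * m * (L ^ 3)⁻¹ ≤ 4 * L ^ 3 := by
    rw [mul_inv_le_iff₀ (pow_pos hL0 3)]
    have hm0 : (m : ℝ) ≤ 2 * L ^ 3 := le_trans (by exact_mod_cast Nat.le_succ m) hm
    have : ((m + 1 : ℕ) : ℝ) * m ≤ (2 * L ^ 3) * (2 * L ^ 3) := mul_le_mul hm hm0 (Nat.cast_nonneg m) (by positivity)
    nlinarith
  calc ((m + 1 : ℕ) : ℝ) * (2 * ((L ^ 3)⁻¹ * (σ ^ 2 * Δ) * S.toReal) * (m * K.toReal))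
      = (((m + 1 : ℕ) : ℝ) * m * (L ^ 3)⁻¹) * (2 * (σ ^ 2 * Δ * S.toReal * K.toReal)) := by ring
    _ ≤ (4 * L ^ 3) * (2 * (σ ^ 2 * Δ * S.toReal * K.toReal)) := mul_le_mul_of_nonneg_right hmm (by positivity)
    _ = 8 * σ ^ 2 * S.toReal * K.toReal * L ^ 3 * Δ := by ring

/-- A term of a double sum of extended non-negative reals is at most the sum. [folklore] -/
theorem le_sum_sum_of_mem {ι κ : Type*} {s : Finset ι} {t : Finset κ} {f : ι → κ → ℝ≥0∞} {a : ι} {b : κ}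
    (ha : a ∈ s) (hb : b ∈ t) : f a b ≤ ∑ x ∈ s, ∑ y ∈ t, f x y :=
  (Finset.single_le_sum (f := f a) (fun _ _ => zero_le) hb).trans
    (Finset.single_le_sum (f := fun x => ∑ y ∈ t, f x y) (fun _ _ => zero_le) ha)

/-! ## The first contact time of a tagged sphere -/

/-- **The first contact time.** A sphere that is not free in the slab `(0, Δ]` has a first participation
time `τ ∈ (0, Δ]`: it participates at `τ` and in no collision at the times of `(0, τ)` (collision times of
a good orbit are locally finite). [cite: GST2013, §4.1] -/
theorem exists_first_participation {n : ℕ} (Ψ : Flows σ) {z : Cell n} (hz : z ∈ (Ψ n).good) {Δ : ℝ} {i : Fin n}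
    (hi : ¬ IsFreeIn Ψ Δ z i) :
    ∃ τ ∈ Set.Ioc 0 Δ, Participates (Euclidean.geometry (Fin 3)) σ ((Ψ n).flow τ z) i ∧
      ∀ s ∈ Set.Ioo 0 τ, ¬ Participates (Euclidean.geometry (Fin 3)) σ ((Ψ n).flow s z) i := by
  unfold IsFreeIn at hi
  push Not at hi
  obtain ⟨s, hs, hps⟩ := hi
  have hγ := (Ψ n).isTrajectory z hz
  have hne : (collisionTimesOf (Euclidean.geometry (Fin 3)) σ (fun t => (Ψ n).flow t z) i ∩ Set.Ioi 0).Nonempty :=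
    ⟨s, hps, hs.1⟩
  have hl := hγ.isLeast_nthCollisionTimeOf_zero hne
  refine ⟨nthCollisionTimeOf (Euclidean.geometry (Fin 3)) σ (fun t => (Ψ n).flow t z) 0 i 0,
    ⟨hl.1.2, (hl.2 ⟨hps, hs.1⟩).trans hs.2⟩, hl.1.1, fun s' hs' hp' => ?_⟩
  exact (not_le.2 hs'.2) (hl.2 ⟨hp', hs'.1⟩)

/-! ## The charging functional of the first-order bound and its expectation -/

/-- **Expectation of the weighted charging count at mesh `M`**: for every label `i` and mesh `M`,
`E_{P_{m+1,L}} ∑_{k<M} (1 + ‖vᵢ‖²) ∑ⱼ 1_{Cyl(Δ/M)}(xᵢ + a_k vᵢ − Xⱼ(a_k), vᵢ − Vⱼ(a_k)) ≤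
2 L⁻³ σ² Δ |S²| · m E[(1 + ‖w‖²)(‖w‖ + 4)]`, `a_k = kΔ/M` (integrated charging bound at each grid time, mean bath
speed, `M · (Δ/M) = Δ`). [cite: CIP1994, App. 4.A] -/
theorem lintegral_weightedCharging_le (hσ : 0 < σ) (hσ' : σ ≤ 3 / 16) (hfac : CellLawFactorises σ) (hL : 1 ≤ L)
    (hm : ((m + 1 : ℕ) : ℝ) ≤ 2 * L ^ 3) (Ψ : Flows σ) (i : Fin (m + 1)) {Δ : ℝ} (hΔ : 0 < Δ) (M : ℕ) :
    ∫⁻ z, ∑ k ∈ Finset.range M, ENNReal.ofReal (1 + ‖(z i).2‖ ^ 2) * ∑ j : Fin m, 1 *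
        {p : V3 × V3 | PairHits σ p.1 p.2 ∧ 0 < pairDisc σ p.1 p.2 ∧ pairHitTime σ p.1 p.2 ∈ Set.Ioc 0 (Δ / M)}.indicator 1
          ((z i).1 + ((k : ℝ) * (Δ / M)) • (z i).2 - ((Ψ m).flow ((k : ℝ) * (Δ / M)) (fun c => z (i.succAbove c)) j).1,
            (z i).2 - ((Ψ m).flow ((k : ℝ) * (Δ / M)) (fun c => z (i.succAbove c)) j).2) ∂cellLaw σ L (m + 1) Ψ ≤
      2 * (ENNReal.ofReal ((L ^ 3)⁻¹) * ENNReal.ofReal (σ ^ 2 * Δ) * sphereMeasure (Set.univ : Set (Metric.sphere (0 : V3) 1))) *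
        (ENNReal.ofReal m * ∫⁻ w, ENNReal.ofReal ((1 + ‖w‖ ^ 2) * (‖w‖ + 4)) ∂stdGaussian V3) := by
  set S : ℝ≥0∞ := sphereMeasure (Set.univ : Set (Metric.sphere (0 : V3) 1)) with hSdef
  set R : Set (V3 × V3) := {p : V3 × V3 | PairHits σ p.1 p.2 ∧ 0 < pairDisc σ p.1 p.2 ∧
    pairHitTime σ p.1 p.2 ∈ Set.Ioc 0 (Δ / M)} with hRdef
  have hR : MeasurableSet R := measurableSet_cylRel σ (Δ / M)
  have hh : 0 ≤ Δ / M := div_nonneg hΔ.le (Nat.cast_nonneg M)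
  have hvol : ∀ u c : V3, ∫⁻ y, R.indicator 1 (y - c, u) ≤ ENNReal.ofReal (σ ^ 2 * (Δ / M) * ‖u‖) * S :=
    fun u c => lintegral_indicator_cylRel_sub_le hσ (Δ / M) u c
  have hWt : Measurable fun w : V3 => ENNReal.ofReal (1 + ‖w‖ ^ 2) :=
    (measurable_const.add (measurable_norm.pow_const 2)).ennreal_ofReal
  have hWb : ∀ j : Fin m, Measurable fun _ : Cell m => (1 : ℝ≥0∞) := fun _ => measurable_const
  have hm0 : (m : ℝ) ≤ 2 * L ^ 3 := le_trans (by exact_mod_cast Nat.le_succ m) hm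
  -- each grid time contributes the same bound
  have hk : ∀ k ∈ Finset.range M, ∫⁻ z, ENNReal.ofReal (1 + ‖(z i).2‖ ^ 2) * ∑ j : Fin m, 1 *
      R.indicator 1 ((z i).1 + ((k : ℝ) * (Δ / M)) • (z i).2 -
        ((Ψ m).flow ((k : ℝ) * (Δ / M)) (fun c => z (i.succAbove c)) j).1,
        (z i).2 - ((Ψ m).flow ((k : ℝ) * (Δ / M)) (fun c => z (i.succAbove c)) j).2) ∂cellLaw σ L (m + 1) Ψ ≤
      2 * (ENNReal.ofReal ((L ^ 3)⁻¹) * ENNReal.ofReal (σ ^ 2 * (Δ / M)) * S) *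
        (ENNReal.ofReal m * ∫⁻ w, ENNReal.ofReal ((1 + ‖w‖ ^ 2) * (‖w‖ + 4)) ∂stdGaussian V3) := by
    intro k _
    have ha : 0 ≤ (k : ℝ) * (Δ / M) := mul_nonneg (Nat.cast_nonneg k) hh
    refine (lintegral_chargingTerm_le hσ hσ' hfac hL hm Ψ i hR hh sphereMeasure_univ_ne_top hvol
      (Wt := fun w : V3 => ENNReal.ofReal (1 + ‖w‖ ^ 2)) hWt (Wb := fun _ _ => (1 : ℝ≥0∞)) hWb _).trans ?_
    refine mul_le_mul' le_rfl ?_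
    calc ∫⁻ w, ENNReal.ofReal (1 + ‖w‖ ^ 2) * ∫⁻ z', ∑ j : Fin m,
          1 * ENNReal.ofReal ‖w - ((Ψ m).flow ((k : ℝ) * (Δ / M)) z' j).2‖ ∂cellLaw σ L m Ψ ∂stdGaussian V3
        ≤ ∫⁻ w, ENNReal.ofReal (1 + ‖w‖ ^ 2) * ENNReal.ofReal (m * (‖w‖ + 4)) ∂stdGaussian V3 := by
          refine lintegral_mono fun w => mul_le_mul' le_rfl ?_
          simp only [one_mul]
          exact lintegral_sum_norm_sub_vel_le hσ' hfac hL hm0 Ψ w ha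
      _ = ENNReal.ofReal m * ∫⁻ w, ENNReal.ofReal ((1 + ‖w‖ ^ 2) * (‖w‖ + 4)) ∂stdGaussian V3 := by
          rw [← lintegral_const_mul' _ _ ENNReal.ofReal_ne_top]
          refine lintegral_congr fun w => ?_
          rw [← ENNReal.ofReal_mul (by positivity), ← ENNReal.ofReal_mul (Nat.cast_nonneg m)]
          congr 1
          ring
  -- sum over the grid
  rw [lintegral_finsetSum _ fun k _ => measurable_chargingTerm Ψ i hR hWt hWb _]
  refine (Finset.sum_le_sum hk).trans ?_
  rw [Finset.sum_const, Finset.card_range, nsmul_eq_mul]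
  have hMΔ : (M : ℝ≥0∞) * ENNReal.ofReal (σ ^ 2 * (Δ / M)) ≤ ENNReal.ofReal (σ ^ 2 * Δ) := by
    rw [← ENNReal.ofReal_natCast, ← ENNReal.ofReal_mul (Nat.cast_nonneg M)]
    refine ENNReal.ofReal_le_ofReal ?_
    rcases Nat.eq_zero_or_pos M with hM | hM
    · subst hM
      simp only [Nat.cast_zero, div_zero, mul_zero]
      positivity
    · have hM' : (M : ℝ) ≠ 0 := by exact_mod_cast hM.ne'
      calc (M : ℝ) * (σ ^ 2 * (Δ / M)) = σ ^ 2 * (Δ / M * M) := by ring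
        _ = σ ^ 2 * Δ := by rw [div_mul_cancel₀ _ hM']
        _ ≤ σ ^ 2 * Δ := le_rfl
  calc (M : ℝ≥0∞) * (2 * (ENNReal.ofReal ((L ^ 3)⁻¹) * ENNReal.ofReal (σ ^ 2 * (Δ / M)) * S) *
        (ENNReal.ofReal m * ∫⁻ w, ENNReal.ofReal ((1 + ‖w‖ ^ 2) * (‖w‖ + 4)) ∂stdGaussian V3))
      = 2 * (ENNReal.ofReal ((L ^ 3)⁻¹) * ((M : ℝ≥0∞) * ENNReal.ofReal (σ ^ 2 * (Δ / M))) * S) *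
        (ENNReal.ofReal m * ∫⁻ w, ENNReal.ofReal ((1 + ‖w‖ ^ 2) * (‖w‖ + 4)) ∂stdGaussian V3) := by ring
    _ ≤ _ := by gcongr

/-! ## The registered sub-goal -/

open Classical in
/-- **Registered sub-goal `stub_clusterTail_firstOrder`** (S2e-1, piece of stub `stub_clusterTail` of the line
`enskog-compensator-martingale`): **the weighted first-order bound of the short-time cluster tail.** For
`0 < σ ≤ 3/16` there is `C` such that for `L ≥ 1`, `n ≤ 2L³`, every cluster dynamics and every slab length
`Δ ∈ (0, 1]`, the expected number of spheres that are NOT free in the slab `(0, Δ]`, weighted by `1 + ‖vᵢ‖²`, is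
`≤ C L³ Δ` — by particle removal: the first contact of a non-free sphere is charged at a grid time to a Boltzmann
cylinder around a sphere of the bath evolved without it (Fatou over the meshes), the inserted position integrates
the cylinder to `σ² (Δ/M) ‖w − V‖ |S²| / L³`, the bath speeds are controlled by energy conservation and the
Maxwellian moments, and `∑ᵢ m / L³ ≤ 4 L³`. [cite: CIP1994, App. 4.A] -/
theorem stub_clusterTail_firstOrder : ∀ σ : ℝ, 0 < σ → σ ≤ 3 / 16 → CellLawFactorises σ →
    ∃ C : ℝ, 0 ≤ C ∧ ∀ L : ℝ, 1 ≤ L → ∀ n : ℕ, (n : ℝ) ≤ 2 * L ^ 3 → ∀ (Ψ : Flows σ) (Δ : ℝ), 0 < Δ → Δ ≤ 1 →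
      ∫⁻ z, ∑ i : Fin n, (if IsFreeIn Ψ Δ z i then 0 else ENNReal.ofReal (1 + ‖(z i).2‖ ^ 2))
          ∂(cellLaw σ L n Ψ) ≤ ENNReal.ofReal (C * L ^ 3 * Δ) := by
  intro σ hσ hσ' hfac
  set S : ℝ≥0∞ := sphereMeasure (Set.univ : Set (Metric.sphere (0 : V3) 1)) with hSdef
  set K : ℝ≥0∞ := ∫⁻ w, ENNReal.ofReal ((1 + ‖w‖ ^ 2) * (‖w‖ + 4)) ∂stdGaussian V3 with hKdef
  have hS : S ≠ ∞ := sphereMeasure_univ_ne_top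
  have hK : K ≠ ∞ := lintegral_weight_lt_top.ne
  refine ⟨8 * σ ^ 2 * S.toReal * K.toReal, by positivity, ?_⟩
  intro L hL n hn Ψ Δ hΔ _hΔ1
  cases n with
  | zero => simp
  | succ m =>
    -- the measurable charging functionals
    set G : ℕ → Cell (m + 1) → ℝ≥0∞ := fun M z => ∑ i : Fin (m + 1), ∑ k ∈ Finset.range M,
      ENNReal.ofReal (1 + ‖(z i).2‖ ^ 2) * ∑ j : Fin m, 1 *
        {p : V3 × V3 | PairHits σ p.1 p.2 ∧ 0 < pairDisc σ p.1 p.2 ∧ pairHitTime σ p.1 p.2 ∈ Set.Ioc 0 (Δ / M)}.indicator 1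
          ((z i).1 + ((k : ℝ) * (Δ / M)) • (z i).2 - ((Ψ m).flow ((k : ℝ) * (Δ / M)) (fun c => z (i.succAbove c)) j).1,
            (z i).2 - ((Ψ m).flow ((k : ℝ) * (Δ / M)) (fun c => z (i.succAbove c)) j).2) with hGdef
    have hWt : Measurable fun w : V3 => ENNReal.ofReal (1 + ‖w‖ ^ 2) :=
      (measurable_const.add (measurable_norm.pow_const 2)).ennreal_ofReal
    have hGm : ∀ M, Measurable (G M) := fun M =>
      Finset.measurable_sum _ fun i _ => Finset.measurable_sum _ fun k _ =>
        measurable_chargingTerm Ψ i (measurableSet_cylRel σ (Δ / M)) hWt (Wb := fun _ _ => (1 : ℝ≥0∞))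
          (fun _ => measurable_const) _
    -- pathwise domination on the good sets
    have hdom : ∀ᵐ z ∂cellLaw σ L (m + 1) Ψ,
        (∑ i : Fin (m + 1), if IsFreeIn Ψ Δ z i then 0 else ENNReal.ofReal (1 + ‖(z i).2‖ ^ 2)) ≤
          liminf (fun M => G M z) atTop := by
      filter_upwards [ae_mem_good_cellLaw σ L (m + 1) Ψ,
        ae_all_iff.2 fun i => ae_removeNth_mem_good hσ hσ' hfac hL hn Ψ i] with z hz hz'
      have hev : ∀ i : Fin (m + 1), ∀ᶠ M : ℕ in atTop,
          (if IsFreeIn Ψ Δ z i then 0 else ENNReal.ofReal (1 + ‖(z i).2‖ ^ 2)) ≤ ∑ k ∈ Finset.range M,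
            ENNReal.ofReal (1 + ‖(z i).2‖ ^ 2) * ∑ j : Fin m, 1 *
              {p : V3 × V3 | PairHits σ p.1 p.2 ∧ 0 < pairDisc σ p.1 p.2 ∧
                  pairHitTime σ p.1 p.2 ∈ Set.Ioc 0 (Δ / M)}.indicator 1
                ((z i).1 + ((k : ℝ) * (Δ / M)) • (z i).2 -
                    ((Ψ m).flow ((k : ℝ) * (Δ / M)) (fun c => z (i.succAbove c)) j).1,
                  (z i).2 - ((Ψ m).flow ((k : ℝ) * (Δ / M)) (fun c => z (i.succAbove c)) j).2) := by
        intro i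
        by_cases hfree : IsFreeIn Ψ Δ z i
        · exact Eventually.of_forall fun M => by rw [if_pos hfree]; exact zero_le
        obtain ⟨τ, hτ, ⟨jj, hcol⟩, hnp⟩ := exists_first_participation Ψ hz hfree
        obtain ⟨j, rfl⟩ := Fin.exists_succAbove_eq hcol.ne.symm
        refine (eventually_exists_grid_charge hσ Ψ hz (hz' i) hτ hcol hnp).mono fun M hM => ?_
        obtain ⟨k, hkM, hmem⟩ := hM
        rw [if_neg hfree]
        simp_rw [Finset.mul_sum]
        refine le_trans (le_of_eq ?_) (le_sum_sum_of_mem (Finset.mem_range.2 hkM) (Finset.mem_univ j))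
        rw [indicator_of_mem hmem, Pi.one_apply, mul_one, mul_one]
      refine le_liminf_of_le (h := (eventually_all.2 hev).mono fun M hM => ?_)
      exact Finset.sum_le_sum fun i _ => hM i
    -- expectation of the charging functionals, uniformly in the mesh
    have hB : ∀ M, ∫⁻ z, G M z ∂cellLaw σ L (m + 1) Ψ ≤ ((m + 1 : ℕ) : ℝ≥0∞) *
        (2 * (ENNReal.ofReal ((L ^ 3)⁻¹) * ENNReal.ofReal (σ ^ 2 * Δ) * S) * (ENNReal.ofReal m * K)) := by
      intro M
      simp only [hGdef]
      rw [lintegral_finsetSum _ fun i _ => Finset.measurable_sum _ fun k _ =>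
        measurable_chargingTerm Ψ i (measurableSet_cylRel σ (Δ / M)) hWt (Wb := fun _ _ => (1 : ℝ≥0∞))
          (fun _ => measurable_const) _]
      refine (Finset.sum_le_sum fun i _ => lintegral_weightedCharging_le hσ hσ' hfac hL hn Ψ i hΔ M).trans ?_
      rw [Finset.sum_const, Finset.card_univ, Fintype.card_fin, nsmul_eq_mul]
    -- Fatou
    calc ∫⁻ z, (∑ i : Fin (m + 1), if IsFreeIn Ψ Δ z i then 0 else ENNReal.ofReal (1 + ‖(z i).2‖ ^ 2))
          ∂cellLaw σ L (m + 1) Ψ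
        ≤ ∫⁻ z, liminf (fun M => G M z) atTop ∂cellLaw σ L (m + 1) Ψ := lintegral_mono_ae hdom
      _ ≤ liminf (fun M => ∫⁻ z, G M z ∂cellLaw σ L (m + 1) Ψ) atTop := lintegral_liminf_le hGm
      _ ≤ ((m + 1 : ℕ) : ℝ≥0∞) *
          (2 * (ENNReal.ofReal ((L ^ 3)⁻¹) * ENNReal.ofReal (σ ^ 2 * Δ) * S) * (ENNReal.ofReal m * K)) :=
        liminf_le_of_frequently_le' (Frequently.of_forall hB)
      _ ≤ ENNReal.ofReal (8 * σ ^ 2 * S.toReal * K.toReal * L ^ 3 * Δ) := firstOrder_bookkeeping hL hΔ.le hn hS hK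

end Summit.AtomisticToContinuum.HydrodynamicLimit.Theorems.EnskogCompensator

end
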